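import Summits.ABC.StewartYu.MatveevRebase
import Summits.ABC.StewartYu.KummerBasisChangeSaturated
import Summits.ABC.StewartYu.MatveevCramerRelation
import Summits.ABC.StewartYu.MatveevLeverMatrix
import Mathlib.LinearAlgebra.Matrix.Nondegenerate
import HarnessLib

/-!
# Cell abc-stewartyu, Gen-3 frames: the data of Matveev's step (Nesterenko 2003, Prop. 2.6) assembled
# from the zero estimate's obstruction lattice — ONE theorem for both frames

`Summits/ABC/StewartYu/MatveevStepData.lean` — cell `abc-stewartyu` (route `PadicPrimesKummerThird`, cruxes
`Y07Odd` stmt-ABC-19658 / `Y07Two` stmt-ABC-19659), seat p3 (g4), F-two lead.  Theorems only; composition of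
landed bricks, no new mathematics.

INPUT (what the END `NesterenkoZeroEnd` exports in its exit C, Nesterenko 2003 Lemma 5.3 / (5.14)): the
obstruction subgroup `H` of `Nesterenko2003_prop51` with its `ℤ`-basis `M` of `Φ = H.chars` (rows independent,
`H.chars = closure(rows M)`), the coefficient vector `b` of the linear form with `b ∈ span_ℚ(rows M)`,
weights `A_l > 0`; and on the arithmetic side nonzero generators `αⱼ` of a field `K`, multiplicatively
independent and `q`-Kummer.  OUTPUT (`exists_matveev_step_data`) = exactly the data of Prop. 2.6 for the
induction step, in the cell's currencies:
* a new `ℤ`-BASIS `Z` of `Φ` (rows `Zⱼ = ∑ₖ yⱼₖ Mₖ`, `span_ℤ Z = span_ℤ M`, independent) with the height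
  bound `∏ⱼ ‖Zⱼ‖_A ≤ (r!)²·nʳ·w(κ)`, `w(κ) = |det M_κ|·∏ A_κ` the maximal weighted minor (`MatveevRebase`);
* the integer relation `m₀ b = ∑ mᵢ Zᵢ`, `m₀ ≠ 0`, with the Cramer–Hadamard bounds (2.11)/(2.12)
  (lit's `LatticeLever.exists_int_relation_weighted`);
* the new generators `θᵢ = ∏ⱼ αⱼ^{Zᵢⱼ}` are multiplicatively independent and `q`-Kummer
  (`KummerBasisChange.mulIndep_and_kummer_of_chars` — `Φ` is saturated).
Plus the `ℤ → ℚ` independence transfer `linearIndependent_ratCast_of_int` the composition needs.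

References: Yu. V. Nesterenko, LNM 1819 (2003), Prop. 2.6, (2.9)–(2.13); Lemma 5.3.
-/

noncomputable section

open Finset
open Literature.NumberTheory.Transcendental
open Literature.NumberTheory.Transcendental.GaGm

namespace Summit.ABC.StewartYu.MatveevStepData

variable {K : Type*} [Field K] {n r : ℕ}

/-- `ℤ`-independent integer rows are `ℚ`-independent (a nonzero `r × r` minor over `ℤ` stays nonzero
over `ℚ`). [folklore] -/
theorem linearIndependent_ratCast_of_int (Z : Fin r → Fin n → ℤ) (hZ : LinearIndependent ℤ Z) :
    LinearIndependent ℚ (fun i => fun k => (Z i k : ℚ)) := by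
  classical
  obtain ⟨e, _he, hdet⟩ :=
    Summit.ABC.StewartYu.MatveevLever.exists_cols_det_ne_zero (Matrix.of Z) hZ
  set B : Matrix (Fin r) (Fin r) ℚ := ((Matrix.of Z).submatrix id e).map (Int.castRingHom ℚ) with hB
  have hBdet : B.det ≠ 0 := by
    rw [hB, Summit.ABC.StewartYu.MatveevLever.det_map_castRingHom]
    exact_mod_cast hdet
  rw [Fintype.linearIndependent_iff]
  intro g hg i
  have hvec : Matrix.vecMul g B = 0 := by
    funext k
    have h := congrFun hg (e k)
    simp only [Finset.sum_apply, Pi.smul_apply, smul_eq_mul, Pi.zero_apply] at h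
    rw [Matrix.vecMul, dotProduct]
    simpa [hB, Matrix.submatrix, Matrix.map_apply, Matrix.of_apply] using h
  exact congrFun (Matrix.eq_zero_of_vecMul_eq_zero hBdet hvec) i

/-- Transport of `ℤ`-span membership to `ℚ`-span membership of the casts. [folklore] -/
theorem mem_span_ratCast_of_mem_span_int (Z : Fin r → Fin n → ℤ) (v : Fin n → ℤ)
    (hv : v ∈ Submodule.span ℤ (Set.range Z)) :
    (fun k => (v k : ℚ)) ∈ Submodule.span ℚ (Set.range fun i => fun k => (Z i k : ℚ)) := by
  classical
  obtain ⟨c, hc⟩ := (Submodule.mem_span_range_iff_exists_fun ℤ).mp hv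
  have hvq : (fun k => (v k : ℚ)) = ∑ i, (c i : ℚ) • (fun k => (Z i k : ℚ)) := by
    funext k
    have h := congrFun hc k
    simp only [Finset.sum_apply, Pi.smul_apply, smul_eq_mul] at h ⊢
    rw [← h]
    push_cast
    rfl
  rw [hvq]
  exact Submodule.sum_mem _ fun i _ => Submodule.smul_mem _ _ (Submodule.subset_span ⟨i, rfl⟩)

/-- **THE DATA OF MATVEEV'S STEP** (Nesterenko 2003, Prop. 2.6, from the obstruction lattice of
Prop. 5.1).  See the module docstring. [cite: Nesterenko2003, Prop 2.6 (2.9)–(2.13)] -/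
theorem exists_matveev_step_data (q : ℕ) (hq : 1 ≤ q) (hr : 0 < r)
    {A : Fin n → ℝ} (hA : ∀ l, 0 < A l)
    (α : Fin n → K) (hα : ∀ j, α j ≠ 0)
    (hind : ∀ φ : Fin n → ℤ, ∏ j, α j ^ φ j = 1 → φ = 0)
    (hK : ∀ φ : Fin n → ℤ, (∃ γ : K, ∏ j, α j ^ φ j = γ ^ q) → ∀ j, (q : ℤ) ∣ φ j)
    (H : ConnAlgSubgroup n) (M : Fin r → Fin n → ℤ) (hM : LinearIndependent ℤ M)
    (hchars : H.chars = AddSubgroup.closure (Set.range M))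
    (b : Fin n → ℤ)
    (hb : (fun k => (b k : ℚ)) ∈ Submodule.span ℚ (Set.range fun i => fun k => (M i k : ℚ))) :
    ∃ (Z : Fin r → Fin n → ℤ) (κ : Fin r → Fin n) (m₀ : ℤ) (mm : Fin r → ℤ) (κ' : Fin r → Fin n),
      LinearIndependent ℤ Z ∧
      Submodule.span ℤ (Set.range Z) = Submodule.span ℤ (Set.range M) ∧
      Function.Injective κ ∧ (Matrix.of fun i j => (M j (κ i) : ℝ)).det ≠ 0 ∧
      (∀ κ₁ : Fin r → Fin n,
        |(Matrix.of fun i j => (M j (κ₁ i) : ℝ)).det| * ∏ i, A (κ₁ i) ≤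
          |(Matrix.of fun i j => (M j (κ i) : ℝ)).det| * ∏ i, A (κ i)) ∧
      ∏ j, (∑ l, A l * |(Z j l : ℝ)|) ≤
        ((r.factorial : ℝ)) ^ 2 * (n : ℝ) ^ r *
          (|(Matrix.of fun i j => (M j (κ i) : ℝ)).det| * ∏ i, A (κ i)) ∧
      Function.Injective κ' ∧ m₀ ≠ 0 ∧ (∀ k, m₀ * b k = ∑ i, mm i * Z i k) ∧
      (|m₀| : ℝ) * ∏ i, A (κ' i) ≤ ∏ i, (∑ k, A k * |(Z i k : ℝ)|) ∧
      (∀ j, (|mm j| : ℝ) * ∏ i, A (κ' i) ≤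
        (∑ i, A (κ' i) * |(b (κ' i) : ℝ)|) * ∏ i ∈ univ.erase j, (∑ k, A k * |(Z i k : ℝ)|)) ∧
      (∀ θ : Fin r → K, (∀ i, θ i = ∏ j, α j ^ Z i j) →
        (∀ μ : Fin r → ℤ, ∏ i, θ i ^ μ i = 1 → μ = 0) ∧
        ∀ c : Fin r → ℤ, (∃ γ : K, ∏ i, θ i ^ c i = γ ^ q) → ∀ i, (q : ℤ) ∣ c i) := by
  classical
  have hMQ := linearIndependent_ratCast_of_int M hM
  -- the re-based basis of `Φ`
  obtain ⟨y, κ, hκ, hyspan, hdet, hmax, hprod⟩ :=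
    Summit.ABC.StewartYu.MatveevRebase.exists_basis_prod_norm_le hr hA M hMQ
  set Z : Fin r → Fin n → ℤ := fun j => ∑ k, y j k • M k with hZdef
  have hZapply : ∀ j l, Z j l = ∑ k, y j k * M k l := by
    intro j l; simp [hZdef, Finset.sum_apply]
  have hZli : LinearIndependent ℤ Z :=
    Summit.ABC.StewartYu.KummerBasisChange.linearIndependent_rows_combination M hM y hyspan
  have hZspan : Submodule.span ℤ (Set.range Z) = Submodule.span ℤ (Set.range M) :=
    Summit.ABC.StewartYu.KummerBasisChange.span_rows_combination_eq M y hyspan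
  -- the product bound, rewritten on `Z`
  have hprodZ : ∏ j, (∑ l, A l * |(Z j l : ℝ)|) ≤
      ((r.factorial : ℝ)) ^ 2 * (n : ℝ) ^ r *
        (|(Matrix.of fun i j => (M j (κ i) : ℝ)).det| * ∏ i, A (κ i)) := by
    have e : ∏ j, (∑ l, A l * |(Z j l : ℝ)|) = ∏ j, (∑ l, A l * |((∑ k, y j k * M k l : ℤ) : ℝ)|) := by
      refine Finset.prod_congr rfl fun j _ => Finset.sum_congr rfl fun l _ => ?_
      rw [hZapply]
    rw [e]; exact hprod
  -- the integer relation `m₀ b = ∑ mᵢ Zᵢ`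
  have hZQ := linearIndependent_ratCast_of_int Z hZli
  have hbZ : (fun k => (b k : ℚ)) ∈ Submodule.span ℚ (Set.range fun i => fun k => (Z i k : ℚ)) := by
    -- `span_ℚ(cast M) ≤ span_ℚ(cast Z)` since each `M k ∈ span_ℤ Z`
    have hle : Submodule.span ℚ (Set.range fun i => fun k => (M i k : ℚ)) ≤
        Submodule.span ℚ (Set.range fun i => fun k => (Z i k : ℚ)) := by
      refine Submodule.span_le.mpr ?_
      rintro _ ⟨k, rfl⟩
      have hk : M k ∈ Submodule.span ℤ (Set.range Z) := by
        rw [hZspan]; exact Submodule.subset_span ⟨k, rfl⟩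
      exact mem_span_ratCast_of_mem_span_int Z (M k) hk
    exact hle hb
  obtain ⟨m₀, mm, κ', hκ', hm₀, hrel, hm₀le, hmle⟩ :=
    Summit.ABC.StewartYu.LatticeLever.exists_int_relation_weighted hA Z hZQ b hbZ
  refine ⟨Z, κ, m₀, mm, κ', hZli, hZspan, hκ, hdet, hmax, hprodZ, hκ', hm₀, hrel, hm₀le, hmle, ?_⟩
  -- independence and Kummer for the new generators
  intro θ hθ
  have hθ' : ∀ i, θ i = ∏ j, α j ^ (∑ k, y i k • M k) j := fun i => by rw [hθ i]
  exact Summit.ABC.StewartYu.KummerBasisChange.mulIndep_and_kummer_of_chars q hq α hα hind hK H M hM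
    hchars y hyspan θ hθ'

end Summit.ABC.StewartYu.MatveevStepData

end
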